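import Summits.ResolutionOfSingularities.ResolutionOfSingularities.Theorems.WeightedInvariantPClassFrobenius
import Summits.ResolutionOfSingularities.ResolutionOfSingularities.Theorems.WeightedInvariantIota3FlagDeltaBridge

/-!
# (F-3d) Row A dominance — TOOLS: the weight filtration of the coordinate flag, linear coefficients,
# Frobenius on coefficients  [OURS · L1 W4.3]

Kernel infrastructure for RE-ENTRY OBJECT #1 of chain w43 (the DOM word at level ≤ 3, door crux
`stmt-ResolutionOfSingularities-19897`), rung (F-3d) «ROW A» of res-D-brk-1's Frobenius-class argument
(O70B-JCAN-PLAN §7), power-series model `S = K⟦X₀, X₁, X₂⟧`.  This file holds the frame-independent tools: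

* §1 `maximalIdeal_eq_span_X` — `𝔪_S = (X_i : i)` (finitely many variables, `K` a field);
* §2 the LINEAR COEFFICIENTS `coeff e_i`: `coeff_single_one_mul` (`coeff e_i (c·g) = c(0)·coeff e_i g` for
  `g(0) = 0`), `linear_coeff_eq_zero_of_mem_span`, and the frame contradiction `false_of_frame`
  («`X₁ ∈ (X₀, v, y)` is impossible when `v, y` have no `X₁`-term»);
* §3 the BRIDGE between res-D-brk-1's two-flag filtration of the COORDINATE flag `(X₂; X₁)` with triple
  `(q; r₁, r₂)` and the weighted order for the integer weights `(q, r₂, r₁)`: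
  `mem_flagContactFiltration_X_iff : g ∈ F_{(X₂;X₁)}(n) ↔ n ≤ weightedOrder (q, r₂, r₁) g`
  (via `flagContactFiltration_eq_monomialIdeal`, Dickson, and the support criterion of file B);
* §4 order and coefficient helpers: `weightedOrder_pow` (domain), `coeff_nsmul_pow_expChar`
  (`coeff (p•m) (f^p) = (coeff m f)^p`), `coeff_pow_eq_zero_of_degree_lt`.

[OURS · L1 W4.3] replaces the role of the completion / initial-form bookkeeping of §7; NOT a statement of
the manuscript.
-/

set_option linter.dupNamespace false

namespace Summit.ResolutionOfSingularities.ResolutionOfSingularities.Theorems.LocalEngine.Iota3.RowA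

open MvPowerSeries IsLocalRing
open Summit.ResolutionOfSingularities.ResolutionOfSingularities.Theorems.LocalEngine.Iota3.PClass
open Summit.ResolutionOfSingularities.ResolutionOfSingularities.Cruxes.HypersurfaceCentreConstruction.LocalEngine.Iota3
open Literature.AlgebraicGeometry.Resolution.CossartPiltant

variable {K : Type*} [Field K]

/-! ## §1 The maximal ideal of `K⟦X_σ⟧` -/

/-- Members of the maximal ideal of `K⟦X_σ⟧` have zero constant term. -/
theorem constantCoeff_eq_zero_of_mem_maximalIdeal {σ : Type*} {f : MvPowerSeries σ K}
    (hf : f ∈ maximalIdeal (MvPowerSeries σ K)) : constantCoeff f = 0 := by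
  by_contra h
  exact (mem_nonunits_iff.mp ((mem_maximalIdeal _).mp hf)) (isUnit_iff_constantCoeff.mpr (Ne.isUnit h))

/-- Series with zero constant term lie in the maximal ideal of `K⟦X_σ⟧`. -/
theorem mem_maximalIdeal_of_constantCoeff_eq_zero {σ : Type*} {f : MvPowerSeries σ K}
    (hf : constantCoeff f = 0) : f ∈ maximalIdeal (MvPowerSeries σ K) :=
  (mem_maximalIdeal _).mpr (mem_nonunits_iff.mpr fun h => by
    have h1 := isUnit_iff_constantCoeff.mp h
    rw [hf] at h1
    exact not_isUnit_zero h1)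

/-- `𝔪 = (X_i : i ∈ σ)` in `K⟦X_σ⟧` for finitely many variables. [folklore] -/
theorem maximalIdeal_eq_span_X {σ : Type*} [Fintype σ] [DecidableEq σ] :
    maximalIdeal (MvPowerSeries σ K) = Ideal.span (Set.range (X : σ → MvPowerSeries σ K)) := by
  apply le_antisymm
  · intro f hf
    have h := mem_span_X_pow_of_exponentClass_eq_zero (p := 1) (f := f)
      (fun e _ => Subsingleton.elim _ _) (constantCoeff_eq_zero_of_mem_maximalIdeal hf)
    simp only [pow_one] at h
    exact h
  · rw [Ideal.span_le]
    rintro _ ⟨i, rfl⟩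
    exact mem_maximalIdeal_of_constantCoeff_eq_zero (constantCoeff_X i)

/-! ## §2 Linear coefficients -/

/-- Below `e_i` there are only `0` and `e_i`. -/
theorem eq_zero_or_eq_of_le_single_one {σ : Type*} {a : σ →₀ ℕ} {i : σ} (h : a ≤ Finsupp.single i 1) :
    a = 0 ∨ a = Finsupp.single i 1 := by
  classical
  have hj : ∀ j, j ≠ i → a j = 0 := fun j hj => by
    have h1 := h j
    rw [Finsupp.single_apply, if_neg (fun h' => hj h'.symm)] at h1
    exact Nat.le_zero.mp h1
  have hi : a i ≤ 1 := by have h1 := h i; rwa [Finsupp.single_eq_same] at h1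
  rcases Nat.le_one_iff_eq_zero_or_eq_one.mp hi with h0 | h1
  · refine Or.inl (Finsupp.ext fun j => ?_)
    by_cases hji : j = i
    · rw [hji, h0, Finsupp.coe_zero, Pi.zero_apply]
    · rw [hj j hji, Finsupp.coe_zero, Pi.zero_apply]
  · refine Or.inr (Finsupp.ext fun j => ?_)
    by_cases hji : j = i
    · rw [hji, h1, Finsupp.single_eq_same]
    · rw [hj j hji, Finsupp.single_apply, if_neg (fun h' => hji h'.symm)]

/-- `coeff e_i (c · g) = c(0) · coeff e_i g` for `g` without constant term. -/
theorem coeff_single_one_mul {σ : Type*} (i : σ) (c g : MvPowerSeries σ K) (hg : constantCoeff g = 0) :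
    coeff (Finsupp.single i 1) (c * g) = constantCoeff c * coeff (Finsupp.single i 1) g := by
  classical
  rw [coeff_mul, Finset.sum_eq_single ((0 : σ →₀ ℕ), Finsupp.single i 1)]
  · rw [coeff_zero_eq_constantCoeff_apply]
  · rintro ⟨a, b⟩ hab hne
    rw [Finset.HasAntidiagonal.mem_antidiagonal] at hab
    dsimp only at hab
    have hle : a ≤ Finsupp.single i 1 := by rw [← hab]; exact le_self_add
    rcases eq_zero_or_eq_of_le_single_one hle with rfl | rfl
    · rw [zero_add] at hab
      exact (hne (by rw [hab])).elim
    · have hb : b = 0 := by simpa using hab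
      rw [hb, coeff_zero_eq_constantCoeff_apply, hg, mul_zero]
  · intro h
    exact absurd (Finset.HasAntidiagonal.mem_antidiagonal.mpr (zero_add _)) h

/-- An ideal generated by series without constant term and without `X_i`-term consists of such series. -/
theorem linear_coeff_eq_zero_of_mem_span {σ : Type*} (i : σ) {s : Set (MvPowerSeries σ K)}
    (hs : ∀ g ∈ s, constantCoeff g = 0 ∧ coeff (Finsupp.single i 1) g = 0) {h : MvPowerSeries σ K}
    (hh : h ∈ Ideal.span s) : constantCoeff h = 0 ∧ coeff (Finsupp.single i 1) h = 0 := by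
  let J : Ideal (MvPowerSeries σ K) :=
    { carrier := {g | constantCoeff g = 0 ∧ coeff (Finsupp.single i 1) g = 0}
      add_mem' := fun {x y} hx hy =>
        ⟨by rw [map_add, hx.1, hy.1, add_zero], by rw [map_add, hx.2, hy.2, add_zero]⟩
      zero_mem' := ⟨map_zero _, map_zero _⟩
      smul_mem' := fun c x hx => ⟨by rw [smul_eq_mul, map_mul, hx.1, mul_zero],
        by rw [smul_eq_mul, coeff_single_one_mul i c x hx.1, hx.2, mul_zero]⟩ }
  have hJ : Ideal.span s ≤ J := Ideal.span_le.mpr fun g hg => hs g hg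
  exact hJ hh

/-- THE FRAME CONTRADICTION: if `v, y` have neither constant nor `X₁`-term, then `X₁ ∉ (X₀, v, y)`. -/
theorem false_of_frame {v y : MvPowerSeries (Fin 3) K}
    (hX1 : (X 1 : MvPowerSeries (Fin 3) K) ∈ Ideal.span {(X 0 : MvPowerSeries (Fin 3) K), v, y})
    (hv0 : constantCoeff v = 0) (hy0 : constantCoeff y = 0)
    (hv1 : coeff (Finsupp.single 1 1) v = 0) (hy1 : coeff (Finsupp.single 1 1) y = 0) : False := by
  have h := (linear_coeff_eq_zero_of_mem_span 1 (s := {(X 0 : MvPowerSeries (Fin 3) K), v, y}) ?_ hX1).2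
  · rw [coeff_index_single_self_X] at h
    exact one_ne_zero h
  · rintro g (rfl | rfl | rfl)
    · exact ⟨constantCoeff_X 0, by rw [coeff_index_single_X, if_neg (by decide)]⟩
    · exact ⟨hv0, hv1⟩
    · exact ⟨hy0, hy1⟩

/-! ## §3 Weights on three variables and the bridge to the two-flag filtration -/

/-- The weight of an exponent in three variables. -/
theorem weight_fin_three (w : Fin 3 → ℕ) (e : Fin 3 →₀ ℕ) :
    Finsupp.weight w e = w 0 * e 0 + w 1 * e 1 + w 2 * e 2 := by
  rw [Finsupp.weight_apply, Finsupp.sum_fintype _ _ (fun i => zero_smul ℕ (w i)), Fin.sum_univ_three]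
  simp only [smul_eq_mul]
  ring

/-- The weight `(q, r₂, r₁)·e` of an exponent. -/
theorem weight_vec (q r₁ r₂ : ℕ) (e : Fin 3 →₀ ℕ) :
    Finsupp.weight ![q, r₂, r₁] e = q * e 0 + r₂ * e 1 + r₁ * e 2 := by
  rw [weight_fin_three]
  rfl

/-- Cossart–Piltant's real weight `frameWeights q r₁ r₂` of an exponent is the integer weight `(q, r₂, r₁)·e`. -/
theorem weight_frameWeights_eq (q r₁ r₂ : ℕ) (e : Fin 3 →₀ ℕ) :
    weight (frameWeights q r₁ r₂) ⇑e = (Finsupp.weight ![q, r₂, r₁] e : ℝ) := by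
  rw [weight_frameWeights, weight_vec]
  push_cast
  ring

/-- Monomials of the coordinate frame: `uPow X e = X^e`. -/
theorem uPow_X_eq_monomial (e : Fin 3 →₀ ℕ) :
    uPow (X : Fin 3 → MvPowerSeries (Fin 3) K) ⇑e = monomial e (1 : K) := by
  rw [monomial_one_eq, Finsupp.prod_fintype _ _ (fun j => pow_zero _)]
  rfl

/-- The weighted order of a product dominates the weighted order of a factor. -/
theorem weightedOrder_le_weightedOrder_mul {σ : Type*} (w : σ → ℕ) (c g : MvPowerSeries σ K) :
    g.weightedOrder w ≤ (c * g).weightedOrder w :=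
  le_trans le_add_self (le_weightedOrder_mul w)

/-- Members of the monomial ideal `I_{(q,r₂,r₁)}(X; n)` have weighted order `≥ n`. -/
theorem le_weightedOrder_of_mem_monomialIdeal (q r₁ r₂ n : ℕ) {g : MvPowerSeries (Fin 3) K}
    (hg : g ∈ monomialIdeal (X : Fin 3 → MvPowerSeries (Fin 3) K) (frameWeights q r₁ r₂) n) :
    (n : ℕ∞) ≤ g.weightedOrder ![q, r₂, r₁] := by
  let J : Ideal (MvPowerSeries (Fin 3) K) :=
    { carrier := {g | (n : ℕ∞) ≤ g.weightedOrder ![q, r₂, r₁]}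
      add_mem' := fun {x y} hx hy => le_trans (le_min hx hy) (min_weightedOrder_le_add _)
      zero_mem' := by simp
      smul_mem' := fun c x hx => le_trans hx (weightedOrder_le_weightedOrder_mul _ c x) }
  have hJ : monomialIdeal (X : Fin 3 → MvPowerSeries (Fin 3) K) (frameWeights q r₁ r₂) n ≤ J := by
    rw [monomialIdeal, Ideal.span_le]
    rintro _ ⟨x, hx, rfl⟩
    show (n : ℕ∞) ≤ (uPow X x).weightedOrder ![q, r₂, r₁]
    have hx' : x = ⇑(Finsupp.equivFunOnFinite.symm x) := (Finsupp.coe_equivFunOnFinite_symm x).symm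
    rw [hx', uPow_X_eq_monomial, weightedOrder_monomial_of_ne_zero _ one_ne_zero, Nat.cast_le]
    rw [hx', weight_frameWeights_eq] at hx
    exact_mod_cast hx
  exact hJ hg

/-- Series of weighted order `≥ n` lie in the monomial ideal `I_{(q,r₂,r₁)}(X; n)` (Dickson + support criterion). -/
theorem mem_monomialIdeal_of_le_weightedOrder (q r₁ r₂ n : ℕ) {g : MvPowerSeries (Fin 3) K}
    (hg : (n : ℕ∞) ≤ g.weightedOrder ![q, r₂, r₁]) :
    g ∈ monomialIdeal (X : Fin 3 → MvPowerSeries (Fin 3) K) (frameWeights q r₁ r₂) n := by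
  classical
  obtain ⟨B₀, hB₀, hle⟩ := exists_finset_forall_exists_le {x : Fin 3 → ℕ | (n : ℝ) ≤ weight (frameWeights q r₁ r₂) x}
  have hmem : g ∈ Ideal.span ((fun a => monomial a (1 : K)) ''
      (↑(B₀.image fun b => Finsupp.equivFunOnFinite.symm b) : Set (Fin 3 →₀ ℕ))) := by
    refine mem_span_monomial_of_coeff _ fun d hd => ?_
    have hwd : (n : ℕ∞) ≤ Finsupp.weight ![q, r₂, r₁] d := hg.trans (weightedOrder_le _ hd)
    have hdB : (⇑d : Fin 3 → ℕ) ∈ {x : Fin 3 → ℕ | (n : ℝ) ≤ weight (frameWeights q r₁ r₂) x} := by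
      show (n : ℝ) ≤ weight (frameWeights q r₁ r₂) ⇑d
      rw [weight_frameWeights_eq]
      exact_mod_cast (show n ≤ Finsupp.weight ![q, r₂, r₁] d by exact_mod_cast hwd)
    obtain ⟨b₀, hb₀, hb₀d⟩ := hle _ hdB
    exact ⟨Finsupp.equivFunOnFinite.symm b₀, Finset.mem_image_of_mem _ hb₀, fun i => hb₀d i⟩
  refine (Ideal.span_le.mpr ?_) hmem
  rintro _ ⟨a, ha, rfl⟩
  obtain ⟨b₀, hb₀, rfl⟩ := Finset.mem_image.mp (Finset.mem_coe.mp ha)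
  show monomial (Finsupp.equivFunOnFinite.symm b₀) (1 : K) ∈ _
  rw [← uPow_X_eq_monomial, Finsupp.coe_equivFunOnFinite_symm]
  exact uPow_mem_monomialIdeal X (hB₀ (Finset.mem_coe.mpr hb₀))

/-- THE BRIDGE: membership in res-D-brk-1's two-flag filtration of the COORDINATE flag `(X₂; X₁)` with
admissible triple `(q; r₁, r₂)` is `weightedOrder (q, r₂, r₁) ≥ n`. -/
theorem mem_flagContactFiltration_X_iff {q r₁ r₂ : ℕ} (hadm : AdmissibleTriple q r₁ r₂) (n : ℕ)
    (g : MvPowerSeries (Fin 3) K) :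
    g ∈ flagContactFiltration (X 2 : MvPowerSeries (Fin 3) K) (X 1) q r₁ r₂ n ↔
      (n : ℕ∞) ≤ g.weightedOrder ![q, r₂, r₁] := by
  classical
  have hm : maximalIdeal (MvPowerSeries (Fin 3) K) =
      Ideal.span (Set.range (X : Fin 3 → MvPowerSeries (Fin 3) K)) := maximalIdeal_eq_span_X
  rw [flagContactFiltration_eq_monomialIdeal X hm hadm n]
  exact ⟨le_weightedOrder_of_mem_monomialIdeal q r₁ r₂ n, mem_monomialIdeal_of_le_weightedOrder q r₁ r₂ n⟩

/-! ## §4 Order and coefficient helpers -/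

/-- Over a domain the weighted order of a power is the multiple of the weighted order. -/
theorem weightedOrder_pow {σ : Type*} (w : σ → ℕ) (f : MvPowerSeries σ K) (n : ℕ) :
    (f ^ n).weightedOrder w = n • f.weightedOrder w := by
  induction n with
  | zero => rw [pow_zero, zero_smul, weightedOrder_one]
  | succ n ih => rw [pow_succ, weightedOrder_mul, ih, succ_nsmul]

/-- A nonzero constant has weighted order `0`. -/
theorem weightedOrder_C {σ : Type*} (w : σ → ℕ) {c : K} (hc : c ≠ 0) :
    (C c : MvPowerSeries σ K).weightedOrder w = 0 := by
  have h := weightedOrder_monomial_of_ne_zero (σ := σ) (d := 0) w hc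
  rwa [map_zero, Nat.cast_zero] at h

/-- FROBENIUS ON COEFFICIENTS: `coeff (p•m) (f^p) = (coeff m f)^p` in exponential characteristic `p`. -/
theorem coeff_nsmul_pow_expChar {σ : Type*} (p : ℕ) [ExpChar K p] (f : MvPowerSeries σ K) (m : σ →₀ ℕ) :
    coeff (p • m) (f ^ p) = (coeff m f) ^ p := by
  rw [← map_frobenius_expand p (expChar_ne_zero K p), coeff_map, coeff_expand_smul, frobenius_def]

/-- Powers of a series without constant term have no coefficients in low degree. -/
theorem coeff_pow_eq_zero_of_degree_lt {σ : Type*} {v : MvPowerSeries σ K} (hv : constantCoeff v = 0)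
    {n : ℕ} {e : σ →₀ ℕ} (he : e.degree < n) : coeff e (v ^ n) = 0 :=
  coeff_of_lt_order (lt_of_lt_of_le (by exact_mod_cast he) (le_order_pow_of_constantCoeff_eq_zero n hv))

/-- The degree of `p • e_i` is `p`. -/
theorem degree_nsmul_single {σ : Type*} (p : ℕ) (i : σ) : (p • Finsupp.single i 1 : σ →₀ ℕ).degree = p := by
  rw [Finsupp.smul_single, smul_eq_mul, mul_one, Finsupp.degree_single]

end Summit.ResolutionOfSingularities.ResolutionOfSingularities.Theorems.LocalEngine.Iota3.RowA
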